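import Literature.Probability.Process.ExitTimeContinuity
import HarnessLib

/-!
# Continuity of the stopped clock of a path functional, at points where it is locally uniformly continuous

Topic `Literature/Probability/Process`; theorems only. Sequel of `ExitTimeContinuity.lean`, which
treats the exit time of the CANONICAL process on `C([0, ∞), ℝ)`.  Level-stopped observables of a
driving process stop at exit times of DERIVED paths — the Loewner flows of boundary marks,
`Φ(w) = (t ↦ realFlowStop w y t)` — which depend continuously on the driving path `w` only
locally uniformly in time and only up to a finite horizon (`Loewner.continuousAt_realFlowStop_driver`,
`LoewnerRealFlowDriverContinuity.lean`: before the mark comes close to the driving point).  This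
file therefore proves the clean-exit continuity for the exit time of `Φ x` where `Φ : X → C([0,∞),ℝ)`
is any map from a topological space which is UNIFORMLY CLOSE ON `[0, b]` near `x₀`
(`∀ ε > 0, ∀ᶠ x, ∀ s ≤ b, |Φ x s − Φ x₀ s| < ε`):

* `eventually_mapsTo_Ioo_of_forall_mem` — compactness margin: if `Φ x₀` maps `[0, v]` into the
  open interval and `v ≤ b`, so does `Φ x` for `x` near `x₀`;
* `eventually_coe_lt_exitTime_comp`, `eventually_exitTime_comp_le` — lower semicontinuity, and
  early exit after a time where `Φ x₀` is outside the closed interval;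
* `continuousAt_untopA_min_exitTime_comp` — for `u < b` and a clean exit (or none) of `Φ x₀`,
  `x ↦ u ∧ τ(Φ x)` is continuous at `x₀`;
* `continuousAt_stoppedClock_comp` — joint continuity in `(u, x)`.

## References

* F. Camia, C. M. Newman, Probab. Theory Related Fields 139 (2007) 473–519, §5. [CamiaNewman2007]
* P. Billingsley, *Convergence of Probability Measures*, 2nd ed. (1999), §2. [Billingsley1999]
-/

noncomputable section

open MeasureTheory Filter Topology Set
open scoped NNReal ENNReal

namespace Literature.Probability.Process

section Local

variable {X : Type*} [TopologicalSpace X] {Φ : X → C(ℝ≥0, ℝ)} {x₀ : X} {b : ℝ≥0} {a a' : ℝ}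

/-- **Compactness margin.**  If `Φ x₀` maps `[0, v]` into the open interval `(a, a')`, `v ≤ b`,
and `Φ x` is uniformly close to `Φ x₀` on `[0, b]` for `x` near `x₀`, then `Φ x` maps `[0, v]`
into `(a, a')` for `x` near `x₀`. [folklore] -/
theorem eventually_mapsTo_Ioo_of_forall_mem
    (hunif : ∀ ε : ℝ, 0 < ε → ∀ᶠ x in 𝓝 x₀, ∀ s : ℝ≥0, s ≤ b → |Φ x s - Φ x₀ s| < ε)
    {v : ℝ≥0} (hv : v ≤ b) (hmaps : ∀ s : ℝ≥0, s ≤ v → Φ x₀ s ∈ Ioo a a') :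
    ∀ᶠ x in 𝓝 x₀, ∀ s : ℝ≥0, s ≤ v → Φ x s ∈ Ioo a a' := by
  -- the image of `[0, v]` is compact inside the open interval: a margin `δ > 0`
  have hK : IsCompact ((fun s : ℝ≥0 ↦ Φ x₀ s) '' Icc 0 v) :=
    isCompact_Icc.image (Φ x₀).continuous
  have hne : (Icc (0 : ℝ≥0) v).Nonempty := ⟨0, left_mem_Icc.2 zero_le⟩
  obtain ⟨s₁, hs₁, hmin⟩ := isCompact_Icc.exists_isMinOn hne (Φ x₀).continuous.continuousOn
  obtain ⟨s₂, hs₂, hmax⟩ := isCompact_Icc.exists_isMaxOn hne (Φ x₀).continuous.continuousOn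
  have h₁ : a < Φ x₀ s₁ := (hmaps s₁ hs₁.2).1
  have h₂ : Φ x₀ s₂ < a' := (hmaps s₂ hs₂.2).2
  set δ : ℝ := min (Φ x₀ s₁ - a) (a' - Φ x₀ s₂) with hδ
  have hδpos : 0 < δ := lt_min (by linarith) (by linarith)
  filter_upwards [hunif δ hδpos] with x hx s hs
  have hclose := abs_sub_lt_iff.1 (hx s (hs.trans hv))
  have hlo : Φ x₀ s₁ ≤ Φ x₀ s := hmin ⟨zero_le, hs⟩
  have hhi : Φ x₀ s ≤ Φ x₀ s₂ := hmax ⟨zero_le, hs⟩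
  have hδ₁ : δ ≤ Φ x₀ s₁ - a := min_le_left _ _
  have hδ₂ : δ ≤ a' - Φ x₀ s₂ := min_le_right _ _
  constructor <;> linarith [hclose.1, hclose.2]

/-- **Lower semicontinuity of the exit time of `Φ x` at `x₀`**: if `↑v < τ(Φ x₀)` and `v ≤ b`,
then `↑v < τ(Φ x)` for `x` near `x₀`. [cite: Billingsley1999, §2] -/
theorem eventually_coe_lt_exitTime_comp
    (hunif : ∀ ε : ℝ, 0 < ε → ∀ᶠ x in 𝓝 x₀, ∀ s : ℝ≥0, s ≤ b → |Φ x s - Φ x₀ s| < ε)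
    {v : ℝ≥0} (hv : v ≤ b)
    (hvτ : (v : WithTop ℝ≥0) < exitTime (fun t (p : C(ℝ≥0, ℝ)) ↦ p t) a a' (Φ x₀)) :
    ∀ᶠ x in 𝓝 x₀, (v : WithTop ℝ≥0) < exitTime (fun t (p : C(ℝ≥0, ℝ)) ↦ p t) a a' (Φ x) := by
  have hmaps : ∀ s : ℝ≥0, s ≤ v → Φ x₀ s ∈ Ioo a a' := fun s hs ↦
    mem_Ioo_of_coe_lt_exitTime (u := fun t (p : C(ℝ≥0, ℝ)) ↦ p t)
      (lt_of_le_of_lt (WithTop.coe_le_coe.2 hs) hvτ)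
  filter_upwards [eventually_mapsTo_Ioo_of_forall_mem hunif hv hmaps] with x hx
  by_contra hle
  rw [not_lt] at hle
  obtain ⟨j, hj, hjmem⟩ := (exitTime_le_coe_iff (u := fun t (p : C(ℝ≥0, ℝ)) ↦ p t)
    (ω := Φ x) (Φ x).continuous).1 hle
  exact hjmem (hx j hj)

/-- If `Φ x₀ s` lies outside `[a, a']` at a time `s ≤ b`, then `τ(Φ x) ≤ s` for `x` near `x₀`.
[folklore] -/
theorem eventually_exitTime_comp_le
    (hunif : ∀ ε : ℝ, 0 < ε → ∀ᶠ x in 𝓝 x₀, ∀ s : ℝ≥0, s ≤ b → |Φ x s - Φ x₀ s| < ε)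
    {s : ℝ≥0} (hsb : s ≤ b) (hs : Φ x₀ s ∉ Icc a a') :
    ∀ᶠ x in 𝓝 x₀, exitTime (fun t (p : C(ℝ≥0, ℝ)) ↦ p t) a a' (Φ x) ≤ s := by
  -- a margin at the single time `s`
  rw [mem_Icc, not_and_or, not_le, not_le] at hs
  obtain ⟨δ, hδ, hout⟩ : ∃ δ : ℝ, 0 < δ ∧ ∀ y : ℝ, |y - Φ x₀ s| < δ → y ∉ Icc a a' := by
    rcases hs with h | h
    · refine ⟨a - Φ x₀ s, by linarith, fun y hy hy' ↦ ?_⟩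
      have := (abs_sub_lt_iff.1 hy).1
      linarith [hy'.1]
    · refine ⟨Φ x₀ s - a', by linarith, fun y hy hy' ↦ ?_⟩
      have := (abs_sub_lt_iff.1 hy).2
      linarith [hy'.2]
  filter_upwards [hunif δ hδ] with x hx
  exact (exitTime_le_coe_iff (u := fun t (p : C(ℝ≥0, ℝ)) ↦ p t) (ω := Φ x) (Φ x).continuous).2
    ⟨s, le_rfl, fun h ↦ hout _ (hx s hsb) (Ioo_subset_Icc_self h)⟩

/-- **Continuity of the stopped clock of `Φ x` at `x₀`, for a clean exit.**  Suppose `Φ x` is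
uniformly close to `Φ x₀` on `[0, b]` for `x` near `x₀`, `u < b`, and the path `Φ x₀` either never
exits `(a, a')` or exits at the finite time `T` cleanly (for every `ε > 0` some `s ∈ (T, T + ε)` has
`Φ x₀ s ∉ [a, a']`).  Then `x ↦ u ∧ τ(Φ x)` (read in `ℝ≥0`) is continuous at `x₀`.
[cite: CamiaNewman2007, §5] -/
theorem continuousAt_untopA_min_exitTime_comp
    (hunif : ∀ ε : ℝ, 0 < ε → ∀ᶠ x in 𝓝 x₀, ∀ s : ℝ≥0, s ≤ b → |Φ x s - Φ x₀ s| < ε)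
    (hclean : ∀ T : ℝ≥0, exitTime (fun t (p : C(ℝ≥0, ℝ)) ↦ p t) a a' (Φ x₀) = T →
      ∀ ε : ℝ, 0 < ε → ∃ s : ℝ≥0, T < s ∧ (s : ℝ) < T + ε ∧ Φ x₀ s ∉ Icc a a')
    {u : ℝ≥0} (hub : u < b) :
    ContinuousAt (fun x ↦
      (min (u : WithTop ℝ≥0) (exitTime (fun t (p : C(ℝ≥0, ℝ)) ↦ p t) a a' (Φ x))).untopA) x₀ := by
  set τ : X → WithTop ℝ≥0 := fun x ↦ exitTime (fun t (p : C(ℝ≥0, ℝ)) ↦ p t) a a' (Φ x) with hτ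
  set c : X → ℝ≥0 := fun x ↦ (min (u : WithTop ℝ≥0) (τ x)).untopA with hc
  rw [ContinuousAt, Metric.tendsto_nhds]
  intro ε hε
  have hcu : ∀ x, c x ≤ u := fun x ↦ untopA_min_coe_le u (τ x)
  -- LOWER bound
  have hlow : ∀ᶠ x in 𝓝 x₀, (c x₀ : ℝ) - ε < c x := by
    by_cases h0 : (c x₀ : ℝ) - ε < 0
    · exact Eventually.of_forall fun x ↦ h0.trans_le (c x).coe_nonneg
    · rw [not_lt] at h0
      set v : ℝ≥0 := ⟨(c x₀ : ℝ) - ε / 2, by linarith⟩ with hv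
      have hvc : v < c x₀ := by
        rw [← NNReal.coe_lt_coe]
        show (c x₀ : ℝ) - ε / 2 < c x₀
        linarith
      have hvu : v ≤ u := hvc.le.trans (hcu x₀)
      have hvτ : (v : WithTop ℝ≥0) < τ x₀ :=
        lt_of_lt_of_le (WithTop.coe_lt_coe.2 hvc) ((coe_untopA_min u (τ x₀)).le.trans
          (min_le_right _ _))
      filter_upwards [eventually_coe_lt_exitTime_comp hunif (hvu.trans hub.le) hvτ] with x hx
      have : v ≤ c x := le_untopA_min_coe_of_coe_lt hvu hx
      have hv' : (v : ℝ) = c x₀ - ε / 2 := rfl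
      calc (c x₀ : ℝ) - ε < c x₀ - ε / 2 := by linarith
        _ = v := hv'.symm
        _ ≤ c x := NNReal.coe_le_coe.2 this
  -- UPPER bound
  have hup : ∀ᶠ x in 𝓝 x₀, (c x : ℝ) < c x₀ + ε := by
    rcases lt_or_ge ((u : WithTop ℝ≥0)) (τ x₀) with hlt | hge
    · have hcu₀ : c x₀ = u := by
        show (min (u : WithTop ℝ≥0) (τ x₀)).untopA = u
        rw [min_eq_left hlt.le]; rfl
      refine Eventually.of_forall fun x ↦ ?_
      rw [hcu₀]
      have := NNReal.coe_le_coe.2 (hcu x)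
      linarith
    · obtain ⟨T, hT⟩ := WithTop.ne_top_iff_exists.1 (ne_top_of_le_ne_top WithTop.coe_ne_top hge)
      have hcT : c x₀ = T := by
        show (min (u : WithTop ℝ≥0) (τ x₀)).untopA = T
        rw [min_eq_right hge, ← hT]; rfl
      have hTu : T ≤ u := by rw [← hcT]; exact hcu x₀
      -- a clean-exit time `s < T + ε'` with `ε' ≤ ε` and `s ≤ b`
      set ε' : ℝ := min ε ((b : ℝ) - u) with hε'
      have hε'pos : 0 < ε' := lt_min hε (by
        have := NNReal.coe_lt_coe.2 hub; linarith)
      obtain ⟨s, hTs, hsε, hs⟩ := hclean T hT.symm ε' hε'pos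
      have hsb : s ≤ b := by
        rw [← NNReal.coe_le_coe]
        have h1 : ε' ≤ (b : ℝ) - u := min_le_right _ _
        have h2 : (T : ℝ) ≤ u := NNReal.coe_le_coe.2 hTu
        linarith
      filter_upwards [eventually_exitTime_comp_le hunif hsb hs] with x hx
      have h1 : c x ≤ s := untopA_min_coe_le_of_le_coe u hx
      have h2 : ε' ≤ ε := min_le_left _ _
      calc (c x : ℝ) ≤ s := NNReal.coe_le_coe.2 h1
        _ < T + ε' := hsε
        _ ≤ c x₀ + ε := by rw [hcT]; linarith
  filter_upwards [hlow, hup] with x h1 h2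
  rw [NNReal.dist_eq]
  exact abs_sub_lt_iff.2 ⟨by linarith, by linarith⟩

/-- **Joint continuity of the stopped clock `(u, x) ↦ u ∧ τ(Φ x)`** at `(u₀, x₀)` for `u₀ < b`,
under the hypotheses of `continuousAt_untopA_min_exitTime_comp` (the clock is `1`-Lipschitz in
time). [folklore] -/
theorem continuousAt_stoppedClock_comp
    (hunif : ∀ ε : ℝ, 0 < ε → ∀ᶠ x in 𝓝 x₀, ∀ s : ℝ≥0, s ≤ b → |Φ x s - Φ x₀ s| < ε)
    (hclean : ∀ T : ℝ≥0, exitTime (fun t (p : C(ℝ≥0, ℝ)) ↦ p t) a a' (Φ x₀) = T →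
      ∀ ε : ℝ, 0 < ε → ∃ s : ℝ≥0, T < s ∧ (s : ℝ) < T + ε ∧ Φ x₀ s ∉ Icc a a')
    {u₀ : ℝ≥0} (hub : u₀ < b) :
    ContinuousAt (fun q : ℝ≥0 × X ↦
      (min (q.1 : WithTop ℝ≥0) (exitTime (fun t (p : C(ℝ≥0, ℝ)) ↦ p t) a a' (Φ q.2))).untopA)
      (u₀, x₀) := by
  set τ : X → WithTop ℝ≥0 := fun x ↦ exitTime (fun t (p : C(ℝ≥0, ℝ)) ↦ p t) a a' (Φ x) with hτ
  rw [ContinuousAt, Metric.tendsto_nhds]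
  intro ε hε
  have h2 : ∀ᶠ x in 𝓝 x₀, dist (min (u₀ : WithTop ℝ≥0) (τ x)).untopA
      (min (u₀ : WithTop ℝ≥0) (τ x₀)).untopA < ε / 2 :=
    Metric.tendsto_nhds.1 (continuousAt_untopA_min_exitTime_comp hunif hclean hub) (ε / 2)
      (half_pos hε)
  have h1 : ∀ᶠ v in 𝓝 u₀, dist v u₀ < ε / 2 := Metric.ball_mem_nhds u₀ (half_pos hε)
  filter_upwards [h1.prod_nhds h2] with q hq
  obtain ⟨hq1, hq2⟩ := hq
  calc dist (min (q.1 : WithTop ℝ≥0) (τ q.2)).untopA (min (u₀ : WithTop ℝ≥0) (τ x₀)).untopA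
      ≤ dist (min (q.1 : WithTop ℝ≥0) (τ q.2)).untopA (min (u₀ : WithTop ℝ≥0) (τ q.2)).untopA +
          dist (min (u₀ : WithTop ℝ≥0) (τ q.2)).untopA (min (u₀ : WithTop ℝ≥0) (τ x₀)).untopA :=
        dist_triangle _ _ _
    _ < ε / 2 + ε / 2 := add_lt_add_of_le_of_lt
        ((dist_untopA_min_coe_le (τ q.2) u₀ q.1).trans hq1.le) hq2
    _ = ε := add_halves ε

/-! ### Any observation time, when the exit is finite and inside the horizon -/

/-- **Continuity of the stopped clock at every observation time, for a finite clean exit inside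
the horizon.**  If `Φ x₀` exits `(a, a')` at the finite time `T < b` cleanly and `Φ x` is uniformly
close to `Φ x₀` on `[0, b]` near `x₀`, then `x ↦ u ∧ τ(Φ x)` is continuous at `x₀` for EVERY `u`
(for `u ≥ b` the clock agrees near `x₀` with the clock observed at a time `< b`, by the early exit of
nearby paths). [cite: CamiaNewman2007, §5] -/
theorem continuousAt_untopA_min_exitTime_comp_of_lt
    (hunif : ∀ ε : ℝ, 0 < ε → ∀ᶠ x in 𝓝 x₀, ∀ s : ℝ≥0, s ≤ b → |Φ x s - Φ x₀ s| < ε)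
    {T : ℝ≥0} (hT : exitTime (fun t (p : C(ℝ≥0, ℝ)) ↦ p t) a a' (Φ x₀) = T) (hTb : T < b)
    (hclean : ∀ ε : ℝ, 0 < ε → ∃ s : ℝ≥0, T < s ∧ (s : ℝ) < T + ε ∧ Φ x₀ s ∉ Icc a a')
    (u : ℝ≥0) :
    ContinuousAt (fun x ↦
      (min (u : WithTop ℝ≥0) (exitTime (fun t (p : C(ℝ≥0, ℝ)) ↦ p t) a a' (Φ x))).untopA) x₀ := by
  have hclean' : ∀ T' : ℝ≥0, exitTime (fun t (p : C(ℝ≥0, ℝ)) ↦ p t) a a' (Φ x₀) = T' →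
      ∀ ε : ℝ, 0 < ε → ∃ s : ℝ≥0, T' < s ∧ (s : ℝ) < T' + ε ∧ Φ x₀ s ∉ Icc a a' := by
    intro T' hT' ε hε
    rw [hT] at hT'
    have : T = T' := by exact_mod_cast hT'
    subst this
    exact hclean ε hε
  rcases lt_or_ge u b with hub | hbu
  · exact continuousAt_untopA_min_exitTime_comp hunif hclean' hub
  · -- an observation time `u' ∈ (T, b)` and an early-exit time `s ∈ (T, u')`
    set u' : ℝ≥0 := ⟨((T : ℝ) + b) / 2, by positivity⟩ with hu'
    have hTb' : (T : ℝ) < b := NNReal.coe_lt_coe.2 hTb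
    have hTu' : T < u' := by
      rw [← NNReal.coe_lt_coe]; show (T : ℝ) < ((T : ℝ) + b) / 2; linarith
    have hu'b : u' < b := by
      rw [← NNReal.coe_lt_coe]; show ((T : ℝ) + b) / 2 < b; linarith
    have hu'u : u' ≤ u := hu'b.le.trans hbu
    obtain ⟨s, hTs, hsu', hs⟩ := hclean ((u' : ℝ) - T) (by
      have := NNReal.coe_lt_coe.2 hTu'; linarith)
    have hsu'' : s ≤ u' := by
      rw [← NNReal.coe_le_coe]; linarith
    have hsb : s ≤ b := hsu''.trans hu'b.le
    -- near `x₀` the exit happens by time `s ≤ u'`, so the clocks at `u` and at `u'` agree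
    have hev : ∀ᶠ x in 𝓝 x₀, (min (u : WithTop ℝ≥0)
        (exitTime (fun t (p : C(ℝ≥0, ℝ)) ↦ p t) a a' (Φ x))).untopA =
        (min (u' : WithTop ℝ≥0) (exitTime (fun t (p : C(ℝ≥0, ℝ)) ↦ p t) a a' (Φ x))).untopA := by
      filter_upwards [eventually_exitTime_comp_le hunif hsb hs] with x hx
      have hτu' : exitTime (fun t (p : C(ℝ≥0, ℝ)) ↦ p t) a a' (Φ x) ≤ (u' : WithTop ℝ≥0) :=
        hx.trans (WithTop.coe_le_coe.2 hsu'')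
      have hτu : exitTime (fun t (p : C(ℝ≥0, ℝ)) ↦ p t) a a' (Φ x) ≤ (u : WithTop ℝ≥0) :=
        hτu'.trans (WithTop.coe_le_coe.2 hu'u)
      rw [min_eq_right hτu, min_eq_right hτu']
    refine (continuousAt_untopA_min_exitTime_comp hunif hclean' hu'b).congr_of_eventuallyEq ?_
    exact hev

/-- **Joint continuity of the stopped clock `(u, x) ↦ u ∧ τ(Φ x)` at `(u₀, x₀)` for every `u₀`**,
for a finite clean exit inside the horizon. [folklore] -/
theorem continuousAt_stoppedClock_comp_of_lt
    (hunif : ∀ ε : ℝ, 0 < ε → ∀ᶠ x in 𝓝 x₀, ∀ s : ℝ≥0, s ≤ b → |Φ x s - Φ x₀ s| < ε)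
    {T : ℝ≥0} (hT : exitTime (fun t (p : C(ℝ≥0, ℝ)) ↦ p t) a a' (Φ x₀) = T) (hTb : T < b)
    (hclean : ∀ ε : ℝ, 0 < ε → ∃ s : ℝ≥0, T < s ∧ (s : ℝ) < T + ε ∧ Φ x₀ s ∉ Icc a a')
    (u₀ : ℝ≥0) :
    ContinuousAt (fun q : ℝ≥0 × X ↦
      (min (q.1 : WithTop ℝ≥0) (exitTime (fun t (p : C(ℝ≥0, ℝ)) ↦ p t) a a' (Φ q.2))).untopA)
      (u₀, x₀) := by
  set τ : X → WithTop ℝ≥0 := fun x ↦ exitTime (fun t (p : C(ℝ≥0, ℝ)) ↦ p t) a a' (Φ x) with hτ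
  rw [ContinuousAt, Metric.tendsto_nhds]
  intro ε hε
  have h2 : ∀ᶠ x in 𝓝 x₀, dist (min (u₀ : WithTop ℝ≥0) (τ x)).untopA
      (min (u₀ : WithTop ℝ≥0) (τ x₀)).untopA < ε / 2 :=
    Metric.tendsto_nhds.1 (continuousAt_untopA_min_exitTime_comp_of_lt hunif hT hTb hclean u₀)
      (ε / 2) (half_pos hε)
  have h1 : ∀ᶠ v in 𝓝 u₀, dist v u₀ < ε / 2 := Metric.ball_mem_nhds u₀ (half_pos hε)
  filter_upwards [h1.prod_nhds h2] with q hq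
  obtain ⟨hq1, hq2⟩ := hq
  calc dist (min (q.1 : WithTop ℝ≥0) (τ q.2)).untopA (min (u₀ : WithTop ℝ≥0) (τ x₀)).untopA
      ≤ dist (min (q.1 : WithTop ℝ≥0) (τ q.2)).untopA (min (u₀ : WithTop ℝ≥0) (τ q.2)).untopA +
          dist (min (u₀ : WithTop ℝ≥0) (τ q.2)).untopA (min (u₀ : WithTop ℝ≥0) (τ x₀)).untopA :=
        dist_triangle _ _ _
    _ < ε / 2 + ε / 2 := add_lt_add_of_le_of_lt
        ((dist_untopA_min_coe_le (τ q.2) u₀ q.1).trans hq1.le) hq2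
    _ = ε := add_halves ε

end Local

end Literature.Probability.Process

end
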